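import Literature.AlgebraicGeometry.HodgeTheory.SupportedClassesHodgeConiveauProofs
import Literature.AlgebraicGeometry.HodgeTheory.LefschetzOneOne
import Literature.NumberTheory.Transcendental.DeRhamTheoremMultiplicative
import Summits.HodgeConjecture.HodgeConjecture.Theorems.AmpleAdicLefschetzThickCodimOneLift
import HarnessLib

/-!
# Route AmpleAdicLefschetz · `ThickCodimOne` (stmt-HodgeConjecture-2618) — THICK in codimension one

The support item `ThickCodimOne` of `Summits/HodgeConjecture/HodgeConjecture/Theses/AmpleAdicLefschetz.lean`
is the calibration `p = 1` of the crux `ThickDescent`: for a closed immersion `f : Y ⟶ X` of smooth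
projective complex varieties whose complement is covered by `|s|` affine opens with `2 + |s| ≤ dim X`,
every DIVISOR class `c ∈ algebraicClasses Y 1 = N¹H²(Y(ℂ); ℂ)` lying in the image of
`f^* : H²(X(ℂ); ℂ) → H²(Y(ℂ); ℂ)` is `f^* a` for a divisor class `a ∈ algebraicClasses X 1`
("Lefschetz `(1,1)` on `X` and `Y` plus the semisimplicity lift of `ThickNecessary`"; for a smooth
ample divisor `Y` of dimension `≥ 3` this is Grothendieck–Lefschetz for `Pic ⊗ ℚ` modulo
homological equivalence, Hartshorne, *Ample Subvarieties*, IV Cor. 3.3).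

This file proves the statement for EVERY morphism `f : Y ⟶ X` of smooth projective complex
varieties — the closed-immersion, affine-cover and range hypotheses of the decl are not used —
CONDITIONALLY on three named facts of the tree (classical theorems of Hodge theory, none of which
is discharged in the tree as of 2026-08-16):

1. `lefschetzOneOne_rational` (`HodgeTheory/LefschetzOneOne`) — Lefschetz's theorem on
   `(1,1)`-classes: on a smooth projective `X`, a rational class of type `(1,1)` is a divisor class
   (Voisin I, Thm. 11.30 with Cor. 11.34 and §11.3.3), used on `X`;
2. `smoothProjective_hodgeStructure_isPolarizable` (`HodgeTheory/HodgeRiemannPolarizability`, taken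
   here in its binder shape `hpol`, the module being that fact's body verbatim) — the Hodge structure
   on `Hᵏ(X(ℂ); ℚ)` of a smooth projective variety is polarisable (Hodge–Riemann, Voisin I Thm. 6.32
   with §7.1.2), through the helper file `AmpleAdicLefschetzThickCodimOneLift`
   (`span_hodge_inf_range_map_le`: Hodge classes in the image of `f^*` lift to Hodge classes —
   Voisin 2025, Cor. 2.12, the "semisimplicity lift");
3. `Grothendieck1969_supportedClasses_le_hodgeConiveau` (`HodgeTheory/SupportedClassesHodgeConiveau`)
   — algebraic classes are of Hodge type `(p, p)` (Grothendieck 1969, p. 300; Voisin I Prop. 11.20),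
   used on `Y`; equivalently (`…_of_deligne`, with the tree's theorems `nonempty_hodgeModel_holds`,
   `exists_deRhamIsoFamily_holds`) Deligne's kernel theorem
   `Deligne1974_ker_restrictCompl_eq_iSup_range_complexGysin` (Hodge III, Cor. 8.2.8) — second form
   `thickCodimOne_of_deligne`.

Proof (the printed argument of the route's `ThickNecessary`, at `p = 1`): `algebraicClasses Y 1`
is the `ℂ`-span of its rational classes (`supportedClasses_eq_span_isRationalClass`, PROVED:
universal coefficients for `Y(ℂ)`), which are of type `(1,1)` by (3); a `ℂ`-combination of rational
`(1,1)`-classes lying in `im f^*` is `f^* a` with `a` a `ℂ`-combination of rational `(1,1)`-classes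
of `X` (helper file, by (2)); and those are divisor classes by (1), `algebraicClasses X 1` being a
`ℂ`-subspace.

In the decl's own range `2 · 1 + |s| ≤ dim X` the polarisability (2) can be traded for the route's
support item `WeakLefschetzInjective` (a hypothesis of the route's deciding theorem `closes` anyway):
`f^*` is then injective on `H²`, and Hodge classes lift along an injective morphism of pure Hodge
structures by STRICTNESS (Deligne, Hodge II, Thm. 2.3.5 (iii) — a theorem of the tree,
`HodgeStructure.Hom.strict_holds`), helper `span_hodge_inf_range_map_le_of_injective`.

Main results: `AmpleAdicLefschetz.exists_mem_algebraicClasses_one_map_eq` (any morphism `f`;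
facts (1), (2), (3)), `AmpleAdicLefschetz.exists_mem_algebraicClasses_one_map_eq_of_injective`
(`f^*` injective on `H²`; facts (1), (3)), and the route decl by name in four conditional forms:
`thickCodimOne_of_lefschetzOneOne` ((1), (2), (3)), `thickCodimOne_of_deligne` ((1), (2), Deligne),
`thickCodimOne_of_weakLefschetzInjective` ((1), (3), item `WeakLefschetzInjective`),
`thickCodimOne_of_deligne_of_weakLefschetzInjective` ((1), Deligne, item `WeakLefschetzInjective`).
Trust base of the item after this file: `lefschetzOneOne_rational` and
`Grothendieck1969_supportedClasses_le_hodgeConiveau` (or Deligne's Cor. 8.2.8), plus EITHER the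
polarisability fact OR the route item `WeakLefschetzInjective`.

## References

* [VoisinHodgeI2002] C. Voisin, Hodge Theory and Complex Algebraic Geometry I (CUP 2002), Thm. 6.32,
  §7.1.2, Lemma 7.26, §7.3.2, Prop. 11.20, Thm. 11.30, §11.3.3.
* [Voisin2025] C. Voisin, Hodge and generalized Hodge conjectures, coniveau and algebraic cycles,
  J. Open Math. Probl. 1 (2025), Prop. 2.11, Cor. 2.12.
* [GrothendieckTopology1969] A. Grothendieck, Hodge's general conjecture is false for trivial
  reasons, Topology 8 (1969), p. 300.
* [Hartshorne1970] R. Hartshorne, Ample Subvarieties of Algebraic Varieties, LNM 156, IV Cor. 3.3.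
* [DeligneHodgeIII1974] P. Deligne, Théorie de Hodge III, Cor. 8.2.8.
-/

noncomputable section

-- `Summit.HodgeConjecture.HodgeConjecture.Theorems` is the mandated namespace (single-problem summit:
-- Problem = Summit), which `linter.dupNamespace` flags; the lakefile turns the linter off tree-wide
-- (weak option), restated here so stand-alone elaboration is warning-free too.
set_option linter.dupNamespace false

namespace Summit.HodgeConjecture.HodgeConjecture.Theorems

open scoped Manifold
open CategoryTheory AlgebraicGeometry
open Literature.AlgebraicGeometry Literature.AlgebraicGeometry.Motives
open Literature.AlgebraicGeometry.HodgeTheory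
open Literature.AlgebraicTopology.SingularHomology
open Literature.NumberTheory.Transcendental (exists_deRhamIsoFamily_holds)

namespace AmpleAdicLefschetz

variable {n m : ℕ} {X Y : SchemeOver ℂ}

/-! ### Algebraic classes are combinations of rational `(p,p)`-classes (Grothendieck's fact) -/

/-- **Algebraic classes are of Hodge type `(p, p)`**, granted Grothendieck's coniveau fact
`Grothendieck1969_supportedClasses_le_hodgeConiveau` (`Nᵖ H²ᵖ` pulled back to a Hodge model lies in
`⨆_{a + b = 2p, a ≥ p, b ≥ p} H^{a,b} = H^{p,p}`; Grothendieck 1969 p. 300, Voisin I Prop. 11.20), for `X`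
smooth projective with a Hodge model `A`. -/
theorem isOfHodgeType_pp_of_mem_algebraicClasses
    (hG : Grothendieck1969_supportedClasses_le_hodgeConiveau) (hX : IsSmoothProjective n X)
    (A : HodgeModel n X) {p : ℕ} {c : complexBetti X (2 * p)} (hc : c ∈ algebraicClasses X p) :
    IsOfHodgeType n X (2 * p) p p c := by
  have h : A.pullback (2 * p) c ∈ A.hodgeConiveau (2 * p) p := hG hX A (2 * p) p ⟨c, hc, rfl⟩
  have hle : A.hodgeConiveau (2 * p) p ≤ A.hodgePQ (2 * p) p p := by
    refine iSup_le fun a ↦ iSup_le fun b ↦ iSup_le fun hab ↦ iSup_le fun ha ↦ iSup_le fun hb ↦ ?_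
    obtain ⟨rfl, rfl⟩ : a = p ∧ b = p := by omega
    exact le_rfl
  exact ⟨A, hle h⟩

/-- **`algebraicClasses X p` lies in the `ℂ`-span of the rational classes of type `(p, p)`**,
granted Grothendieck's fact: `Nᵖ H²ᵖ(X(ℂ); ℂ)` is the complex span of its rational classes
(`supportedClasses_eq_span_isRationalClass`, universal coefficients — a theorem of the tree), and
those are of type `(p, p)` (`isOfHodgeType_pp_of_mem_algebraicClasses`, in a real Hodge model,
`exists_isReal_hodgeModel_holds`). -/
theorem algebraicClasses_le_span_hodge (hG : Grothendieck1969_supportedClasses_le_hodgeConiveau)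
    (hX : IsSmoothProjective n X) (p : ℕ) :
    algebraicClasses X p ≤ Submodule.span ℂ {a : complexBetti X (2 * p) |
      IsRationalClass a ∧ IsOfHodgeType n X (2 * p) p p a} := by
  obtain ⟨A, -⟩ := exists_isReal_hodgeModel_holds n X hX
  intro c hc
  have hc' : c ∈ Submodule.span ℂ {a : complexBetti X (2 * p) |
      IsRationalClass a ∧ a ∈ supportedClasses X (2 * p) p} := by
    rw [← supportedClasses_eq_span_isRationalClass hX (2 * p) p]
    exact hc
  refine Submodule.span_mono (fun a ha ↦ ?_) hc'
  exact ⟨ha.1, isOfHodgeType_pp_of_mem_algebraicClasses hG hX A ha.2⟩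

/-! ### Rational `(p,p)`-classes are algebraic where the Hodge conjecture holds (at `p = 1`: Lefschetz `(1,1)`) -/

/-- **The `ℂ`-span of the rational `(p,p)`-classes lies in `algebraicClasses X p`** as soon as the
Hodge conjecture holds for `X` in codimension `p` (hypothesis `hHC`: every rational class of type
`(p, p)` in `H²ᵖ(X(ℂ); ℂ)` is algebraic), `algebraicClasses X p = Nᵖ H²ᵖ(X(ℂ); ℂ)` being a
`ℂ`-subspace. -/
theorem span_hodge_le_algebraicClasses {p : ℕ}
    (hHC : ∀ a : complexBetti X (2 * p), IsRationalClass a → IsOfHodgeType n X (2 * p) p p a →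
      a ∈ algebraicClasses X p) :
    Submodule.span ℂ {a : complexBetti X (2 * p) |
        IsRationalClass a ∧ IsOfHodgeType n X (2 * p) p p a} ≤ algebraicClasses X p :=
  Submodule.span_le.2 fun a ha ↦ hHC a ha.1 ha.2

/-! ### THICK in codimension `p` where the Hodge conjecture holds on `X`; codimension one -/

/-- **THICK in codimension `p` for any morphism, granted the Hodge conjecture on `X` in codimension
`p`** (the printed argument of the route's `ThickNecessary`). Let `f : Y ⟶ X` be a morphism of smooth
projective complex varieties (dimensions `m`, `n`) and `p : ℕ`. Granted the polarisability of the
Hodge structures of smooth projective varieties (`hpol`, the body of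
`smoothProjective_hodgeStructure_isPolarizable`), Grothendieck's coniveau fact (`hG`, on `Y`) and the
Hodge conjecture for `X` in codimension `p` (`hHC`): every `c ∈ algebraicClasses Y p` in the image of
`f^* : H²ᵖ(X(ℂ); ℂ) → H²ᵖ(Y(ℂ); ℂ)` is `f^* a` for some `a ∈ algebraicClasses X p`. Proof: `c` is a
`ℂ`-combination of rational `(p,p)`-classes (`algebraicClasses_le_span_hodge`), hence `f^* a` with `a`
a `ℂ`-combination of rational `(p,p)`-classes of `X` (Voisin 2025 Cor. 2.12 for `f^*`,
`exists_mem_span_hodge_map_eq`), and `a` is algebraic by `hHC` (`span_hodge_le_algebraicClasses`). -/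
theorem exists_mem_algebraicClasses_map_eq
    (hpol : ∀ ⦃m : ℕ⦄ ⦃Y : SchemeOver ℂ⦄ (hY : IsSmoothProjective m Y) (A : HodgeModel m Y)
      (hA : A.IsHodgeSymmetric) (k : ℕ), (A.hodgeStructure hY hA k).IsPolarizable)
    (hG : Grothendieck1969_supportedClasses_le_hodgeConiveau)
    (hX : IsSmoothProjective n X) (hY : IsSmoothProjective m Y) (f : Y ⟶ X) {p : ℕ}
    (hHC : ∀ a : complexBetti X (2 * p), IsRationalClass a → IsOfHodgeType n X (2 * p) p p a →
      a ∈ algebraicClasses X p)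
    {c : complexBetti Y (2 * p)} (hc : c ∈ algebraicClasses Y p)
    (hcf : c ∈ LinearMap.range (complexBetti.map f (2 * p)).hom) :
    ∃ a ∈ algebraicClasses X p, complexBetti.map f (2 * p) a = c := by
  obtain ⟨a, ha, hac⟩ := exists_mem_span_hodge_map_eq hpol hX hY f
    (algebraicClasses_le_span_hodge hG hY p hc) hcf
  exact ⟨a, span_hodge_le_algebraicClasses hHC ha, hac⟩

/-- **The same with `f^*` INJECTIVE in degree `2p` and no polarisation** (the weak Lefschetz range):
granted Grothendieck's coniveau fact (`hG`, on `Y`) and the Hodge conjecture for `X` in codimension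
`p` (`hHC`), every `c ∈ algebraicClasses Y p` in the image of the injective `f^*` is `f^* a` for some
`a ∈ algebraicClasses X p` — the lift along an injective morphism of pure Hodge structures is its
strictness (Deligne, Hodge II, Thm. 2.3.5 (iii); `exists_mem_span_hodge_map_eq_of_injective`). -/
theorem exists_mem_algebraicClasses_map_eq_of_injective
    (hG : Grothendieck1969_supportedClasses_le_hodgeConiveau)
    (hX : IsSmoothProjective n X) (hY : IsSmoothProjective m Y) (f : Y ⟶ X) {p : ℕ}
    (hf : Function.Injective (complexBetti.map f (2 * p)).hom)
    (hHC : ∀ a : complexBetti X (2 * p), IsRationalClass a → IsOfHodgeType n X (2 * p) p p a →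
      a ∈ algebraicClasses X p)
    {c : complexBetti Y (2 * p)} (hc : c ∈ algebraicClasses Y p)
    (hcf : c ∈ LinearMap.range (complexBetti.map f (2 * p)).hom) :
    ∃ a ∈ algebraicClasses X p, complexBetti.map f (2 * p) a = c := by
  obtain ⟨a, ha, hac⟩ := exists_mem_span_hodge_map_eq_of_injective hX hY f hf
    (algebraicClasses_le_span_hodge hG hY p hc) hcf
  exact ⟨a, span_hodge_le_algebraicClasses hHC ha, hac⟩

/-- **Grothendieck–Lefschetz for divisor classes modulo homological equivalence, for any morphism.**
Let `f : Y ⟶ X` be a morphism of smooth projective complex varieties (dimensions `m`, `n`). Granted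
Lefschetz `(1,1)` (`h11`, on `X`), the polarisability of the Hodge structures of smooth projective
varieties (`hpol`) and Grothendieck's coniveau fact (`hG`, on `Y`): every `c ∈ algebraicClasses Y 1`
in the image of `f^* : H²(X(ℂ); ℂ) → H²(Y(ℂ); ℂ)` is `f^* a` for some `a ∈ algebraicClasses X 1`
(`exists_mem_algebraicClasses_map_eq` at `p = 1`, where `hHC` is Lefschetz `(1,1)`). -/
theorem exists_mem_algebraicClasses_one_map_eq (h11 : lefschetzOneOne_rational)
    (hpol : ∀ ⦃m : ℕ⦄ ⦃Y : SchemeOver ℂ⦄ (hY : IsSmoothProjective m Y) (A : HodgeModel m Y)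
      (hA : A.IsHodgeSymmetric) (k : ℕ), (A.hodgeStructure hY hA k).IsPolarizable)
    (hG : Grothendieck1969_supportedClasses_le_hodgeConiveau)
    (hX : IsSmoothProjective n X) (hY : IsSmoothProjective m Y) (f : Y ⟶ X)
    {c : complexBetti Y (2 * 1)} (hc : c ∈ algebraicClasses Y 1)
    (hcf : c ∈ LinearMap.range (complexBetti.map f (2 * 1)).hom) :
    ∃ a ∈ algebraicClasses X 1, complexBetti.map f (2 * 1) a = c :=
  exists_mem_algebraicClasses_map_eq hpol hG hX hY f (h11 hX) hc hcf

/-- **The same in the weak Lefschetz range, with no polarisation**: if moreover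
`f^* : H²(X(ℂ); ℂ) → H²(Y(ℂ); ℂ)` is INJECTIVE (e.g. `X ∖ f(Y)` covered by `k` affine opens with
`2 + k ≤ dim X` — the route's support item `WeakLefschetzInjective`), then granted only Lefschetz
`(1,1)` (`h11`, on `X`) and Grothendieck's coniveau fact (`hG`, on `Y`), every `c ∈ algebraicClasses Y 1`
in the image of `f^*` is `f^* a` for some `a ∈ algebraicClasses X 1`
(`exists_mem_algebraicClasses_map_eq_of_injective` at `p = 1`). -/
theorem exists_mem_algebraicClasses_one_map_eq_of_injective (h11 : lefschetzOneOne_rational)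
    (hG : Grothendieck1969_supportedClasses_le_hodgeConiveau)
    (hX : IsSmoothProjective n X) (hY : IsSmoothProjective m Y) (f : Y ⟶ X)
    (hf : Function.Injective (complexBetti.map f (2 * 1)).hom)
    {c : complexBetti Y (2 * 1)} (hc : c ∈ algebraicClasses Y 1)
    (hcf : c ∈ LinearMap.range (complexBetti.map f (2 * 1)).hom) :
    ∃ a ∈ algebraicClasses X 1, complexBetti.map f (2 * 1) a = c :=
  exists_mem_algebraicClasses_map_eq_of_injective hG hX hY f hf (h11 hX) hc hcf

end AmpleAdicLefschetz

/-! ### The route decl -/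

/-- **`ThickCodimOne` (item stmt-HodgeConjecture-2618, the route decl by name), CONDITIONAL on the
named facts `lefschetzOneOne_rational` (Lefschetz `(1,1)`), the polarisability of the Hodge structures
of smooth projective varieties (`hpol` = the body of `smoothProjective_hodgeStructure_isPolarizable`,
Hodge–Riemann) and `Grothendieck1969_supportedClasses_le_hodgeConiveau` (algebraic classes are
`(p,p)`).** The closed-immersion, affine-cover and range hypotheses of the decl are not needed:
`AmpleAdicLefschetz.exists_mem_algebraicClasses_one_map_eq` holds for every morphism `f`. -/
theorem thickCodimOne_of_lefschetzOneOne (h11 : lefschetzOneOne_rational)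
    (hpol : ∀ ⦃m : ℕ⦄ ⦃Y : SchemeOver ℂ⦄ (hY : IsSmoothProjective m Y) (A : HodgeModel m Y)
      (hA : A.IsHodgeSymmetric) (k : ℕ), (A.hodgeStructure hY hA k).IsPolarizable)
    (hG : Grothendieck1969_supportedClasses_le_hodgeConiveau) :
    Summit.HodgeConjecture.HodgeConjecture.Theses.AmpleAdicLefschetz.ThickCodimOne := by
  intro n m X Y f hX hY _ _ _ _ _ c hc hcf
  exact AmpleAdicLefschetz.exists_mem_algebraicClasses_one_map_eq h11 hpol hG hX hY f hc hcf

/-- **`ThickCodimOne` from Lefschetz `(1,1)`, polarisability and DELIGNE's kernel theorem**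
(`Deligne1974_ker_restrictCompl_eq_iSup_range_complexGysin`, Hodge III Cor. 8.2.8, which implies
Grothendieck's coniveau fact through the tree's `Grothendieck1969_supportedClasses_le_hodgeConiveau_of_deligne`,
fed with the theorems `nonempty_hodgeModel_holds` and `exists_deRhamIsoFamily_holds`) — the route
decl by name, CONDITIONAL on these three named facts. -/
theorem thickCodimOne_of_deligne (h11 : lefschetzOneOne_rational)
    (hpol : ∀ ⦃m : ℕ⦄ ⦃Y : SchemeOver ℂ⦄ (hY : IsSmoothProjective m Y) (A : HodgeModel m Y)
      (hA : A.IsHodgeSymmetric) (k : ℕ), (A.hodgeStructure hY hA k).IsPolarizable)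
    (hD : Deligne1974_ker_restrictCompl_eq_iSup_range_complexGysin) :
    Summit.HodgeConjecture.HodgeConjecture.Theses.AmpleAdicLefschetz.ThickCodimOne :=
  thickCodimOne_of_lefschetzOneOne h11 hpol
    (Grothendieck1969_supportedClasses_le_hodgeConiveau_of_deligne hD
      (fun _ _ ↦ nonempty_hodgeModel_holds) (fun E _ _ _ ↦ exists_deRhamIsoFamily_holds E))

/-- **`ThickCodimOne` from Lefschetz `(1,1)`, Grothendieck's coniveau fact and the route's own
support item `WeakLefschetzInjective`** (weak Lefschetz, injectivity half, in affine-cover form) —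
NO polarisability: in the decl's range `2 · 1 + |s| ≤ dim X` the item `WeakLefschetzInjective` makes
`f^* : H²(X(ℂ); ℂ) → H²(Y(ℂ); ℂ)` injective, and the lift of Hodge classes along an injective morphism
of pure Hodge structures is its strictness (Deligne, Hodge II, Thm. 2.3.5 (iii), a theorem of the
tree), `AmpleAdicLefschetz.exists_mem_algebraicClasses_one_map_eq_of_injective`. Since the route's
deciding theorem `closes` takes `WeakLefschetzInjective` as a hypothesis anyway, this form costs the
route only the two classical facts `lefschetzOneOne_rational` and
`Grothendieck1969_supportedClasses_le_hodgeConiveau`. -/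
theorem thickCodimOne_of_weakLefschetzInjective (h11 : lefschetzOneOne_rational)
    (hG : Grothendieck1969_supportedClasses_le_hodgeConiveau)
    (hW : Summit.HodgeConjecture.HodgeConjecture.Theses.AmpleAdicLefschetz.WeakLefschetzInjective) :
    Summit.HodgeConjecture.HodgeConjecture.Theses.AmpleAdicLefschetz.ThickCodimOne := by
  intro n m X Y f hX hY hf s hs hcov hle c hc hcf
  have hinj : Function.Injective (complexBetti.map f (2 * 1)).hom :=
    fun a b h ↦ hW f hX hf s hs hcov (2 * 1) hle h
  exact AmpleAdicLefschetz.exists_mem_algebraicClasses_one_map_eq_of_injective h11 hG hX hY f hinj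
    hc hcf

/-- **`ThickCodimOne` from Lefschetz `(1,1)`, DELIGNE's kernel theorem and `WeakLefschetzInjective`**
(Grothendieck's coniveau fact through `Grothendieck1969_supportedClasses_le_hodgeConiveau_of_deligne`). -/
theorem thickCodimOne_of_deligne_of_weakLefschetzInjective (h11 : lefschetzOneOne_rational)
    (hD : Deligne1974_ker_restrictCompl_eq_iSup_range_complexGysin)
    (hW : Summit.HodgeConjecture.HodgeConjecture.Theses.AmpleAdicLefschetz.WeakLefschetzInjective) :
    Summit.HodgeConjecture.HodgeConjecture.Theses.AmpleAdicLefschetz.ThickCodimOne :=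
  thickCodimOne_of_weakLefschetzInjective h11
    (Grothendieck1969_supportedClasses_le_hodgeConiveau_of_deligne hD
      (fun _ _ ↦ nonempty_hodgeModel_holds) (fun E _ _ _ ↦ exists_deRhamIsoFamily_holds E)) hW

end Summit.HodgeConjecture.HodgeConjecture.Theorems

end
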